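import Summits.Parity.GeneralizedHardyLittlewood.Theorems.LeeYangFibresFibrationLemmaDefs
import Literature.NumberTheory.Sieve.ConvexBodyLatticePoints
import Mathlib.MeasureTheory.Measure.Lebesgue.EqHaar
import Mathlib.MeasureTheory.Group.Measure
import HarnessLib

/-!
# Fibration lemma (`DimOne → GeneralizedHardyLittlewood`), part 5: equidistribution of periodic weights

Support file for the statement item `FibrationLemma : DimOne → GeneralizedHardyLittlewood`
(Green–Tao 2010, §1, remark after Conj. 1.2). The head `∏_{p ≤ z} β_p(Φ_w)` of the singular product
of the fibre system over `w` is a `Q`-periodic function of the base point `w` (`Q = ∏_{p ≤ z} p`), and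
its average over the residues `w mod Q` is the head of the singular product of `Ψ` (parts 1 and 4).
This file supplies the geometric input that turns periodicity into an asymptotic: for a convex body
`K ⊆ [-N, N]^{d+1}` and a `Q`-periodic function `F` on `ℤ^d` bounded by `F_max`,

  `|∑_{n ∈ K ∩ ℤ^{d+1}} F(n₁, …, n_d) - vol(K) · 𝔼_{r ∈ (ℤ/Q)^d} F(r)| ≤ F_max · Q^d · (d+1) 4^d (2N)^d`

(`abs_sum_periodic_sub_volume_mul_le`). Proof: split `K ∩ ℤ^{d+1}` according to the residue class
`r` of the first `d` coordinates; the class of `r` is in bijection (`n = (r + Q u', u_{d+1})`,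
`card_residueClass_eq`) with the lattice points of the convex body `K_r = T_r⁻¹(K) ⊆ [-2N, 2N]^{d+1}`
(`classBody`), `T_r(x) = (r + Q x', x_{d+1})`, whose volume is `vol(K)/Q^d` (`volume_classBody`:
a translate of the preimage under the diagonal linear map `diag(Q, …, Q, 1)`), and Green–Tao's
lattice point count (App. A, in the tree as `LatticePointsConvexBody.abs_card_sub_volume_le`) gives
`#(K_r ∩ ℤ^{d+1}) = vol(K)/Q^d + O_d(N^d)` for each of the `Q^d` classes.
-/

noncomputable section

open Finset MeasureTheory

namespace Summit.Parity.GeneralizedHardyLittlewood.Theorems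

open Literature.NumberTheory.Sieve

variable {d : ℕ}

/-! ### Residue classes of the base coordinates -/

/-- The residues mod `Q` of the first `d` coordinates of a lattice point of `ℤ^{d+1}`, as a vector
of natural numbers `< Q`. [folklore] -/
def baseResidue (Q : ℕ) (n : Fin (d + 1) → ℤ) : Fin d → ℕ :=
  fun j => (n (Fin.castSucc j) % Q).toNat

/-- `baseResidue Q n ∈ {0, …, Q-1}^d` for `Q ≥ 1`. [folklore] -/
theorem baseResidue_mem (Q : ℕ) (hQ : 1 ≤ Q) (n : Fin (d + 1) → ℤ) :
    baseResidue Q n ∈ Fintype.piFinset fun _ : Fin d => range Q := by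
  refine Fintype.mem_piFinset.mpr fun j => Finset.mem_range.mpr ?_
  have hQ0 : (0 : ℤ) < Q := by exact_mod_cast hQ
  have h1 : 0 ≤ n (Fin.castSucc j) % Q := Int.emod_nonneg _ hQ0.ne'
  have h2 : n (Fin.castSucc j) % Q < Q := Int.emod_lt_of_pos _ hQ0
  unfold baseResidue
  zify
  rw [Int.toNat_of_nonneg h1]
  exact h2

/-- The cast of `baseResidue` back to `ℤ` is the remainder. [folklore] -/
theorem natCast_baseResidue (Q : ℕ) (hQ : 1 ≤ Q) (n : Fin (d + 1) → ℤ) (j : Fin d) :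
    ((baseResidue Q n j : ℕ) : ℤ) = n (Fin.castSucc j) % Q := by
  have hQ0 : (0 : ℤ) < Q := by exact_mod_cast hQ
  unfold baseResidue
  exact Int.toNat_of_nonneg (Int.emod_nonneg _ hQ0.ne')

/-- `init n ≡ baseResidue Q n (mod Q)` coordinatewise. [folklore] -/
theorem init_cast_zmod_eq_baseResidue (Q : ℕ) (hQ : 1 ≤ Q) (n : Fin (d + 1) → ℤ) (j : Fin d) :
    ((Fin.init n j : ℤ) : ZMod Q) = (((baseResidue Q n j : ℕ) : ℤ) : ZMod Q) := by
  rw [natCast_baseResidue Q hQ, ZMod.intCast_mod]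
  rfl

/-! ### The rescaling maps of a residue class -/

/-- The lattice map `u ↦ (r + Q u', u_{d+1})` parametrising the residue class of `r`. [folklore] -/
def classLatticeMap (Q : ℕ) (r : Fin d → ℕ) (u : Fin (d + 1) → ℤ) : Fin (d + 1) → ℤ :=
  Fin.snoc (fun j => (r j : ℤ) + Q * u (Fin.castSucc j)) (u (Fin.last d))

/-- Its inverse on the class: `n ↦ (n' / Q, n_{d+1})` (floor division). [folklore] -/
def classLatticeInv (Q : ℕ) (n : Fin (d + 1) → ℤ) : Fin (d + 1) → ℤ :=
  Fin.snoc (fun j => n (Fin.castSucc j) / Q) (n (Fin.last d))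

/-- The real affine map `T_r(x) = (r + Q x', x_{d+1})`. [folklore] -/
def classRealMap (Q : ℕ) (r : Fin d → ℕ) (x : Fin (d + 1) → ℝ) : Fin (d + 1) → ℝ :=
  Fin.snoc (fun j => (r j : ℝ) + Q * x (Fin.castSucc j)) (x (Fin.last d))

/-- `realPoint ∘ Λ_r = T_r ∘ realPoint`. [folklore] -/
theorem realPoint_classLatticeMap (Q : ℕ) (r : Fin d → ℕ) (u : Fin (d + 1) → ℤ) :
    realPoint (classLatticeMap Q r u) = classRealMap Q r (realPoint u) := by
  funext k
  refine Fin.lastCases ?_ (fun j => ?_) k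
  · simp [realPoint, classLatticeMap, classRealMap]
  · simp [realPoint, classLatticeMap, classRealMap]

/-- The body `K_r = T_r⁻¹(K)`. [folklore] -/
def classBody (Q : ℕ) (r : Fin d → ℕ) (K : Set (Fin (d + 1) → ℝ)) : Set (Fin (d + 1) → ℝ) :=
  classRealMap Q r ⁻¹' K

/-- `T_r` respects convex combinations. [folklore] -/
theorem classRealMap_convex_comb (Q : ℕ) (r : Fin d → ℕ) (x y : Fin (d + 1) → ℝ) (a b : ℝ)
    (hab : a + b = 1) :
    classRealMap Q r (a • x + b • y) = a • classRealMap Q r x + b • classRealMap Q r y := by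
  funext k
  refine Fin.lastCases ?_ (fun j => ?_) k
  · simp [classRealMap]
  · simp only [classRealMap, Fin.snoc_castSucc, Pi.add_apply, Pi.smul_apply, smul_eq_mul]
    linear_combination (-(r j : ℝ)) * hab

/-- `K_r` is convex if `K` is. [folklore] -/
theorem convex_classBody (Q : ℕ) (r : Fin d → ℕ) {K : Set (Fin (d + 1) → ℝ)} (hK : Convex ℝ K) :
    Convex ℝ (classBody Q r K) := by
  intro x hx y hy a b ha hb hab
  simp only [classBody, Set.mem_preimage] at hx hy ⊢
  rw [classRealMap_convex_comb Q r x y a b hab]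
  exact hK hx hy ha hb hab

/-- `K_r ⊆ [-2N, 2N]^{d+1}` if `K ⊆ [-N, N]^{d+1}`, `N ≥ 1`, `Q ≥ 1` and `r ∈ {0,…,Q-1}^d`. [folklore] -/
theorem classBody_subset_realBox (Q : ℕ) (hQ : 1 ≤ Q) {r : Fin d → ℕ} (hr : ∀ j, r j < Q)
    {K : Set (Fin (d + 1) → ℝ)} {N : ℕ} (hN : 1 ≤ N) (hK : K ⊆ realBox (d + 1) N) :
    classBody Q r K ⊆ realBox (d + 1) (2 * N : ℕ) := by
  intro x hx
  have h := hK hx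
  simp only [realBox, Set.mem_Icc, Pi.le_def] at h ⊢
  have hN' : (1 : ℝ) ≤ N := by exact_mod_cast hN
  have hQ' : (1 : ℝ) ≤ Q := by exact_mod_cast hQ
  have hQ0 : (0 : ℝ) < Q := by linarith
  push_cast
  refine ⟨fun k => ?_, fun k => ?_⟩
  · refine Fin.lastCases ?_ (fun j => ?_) k
    · have := h.1 (Fin.last d)
      simp only [classRealMap, Fin.snoc_last] at this
      linarith
    · have h1 := h.1 (Fin.castSucc j)
      simp only [classRealMap, Fin.snoc_castSucc] at h1
      have hrj : (r j : ℝ) ≤ Q - 1 := by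
        have : (r j : ℝ) + 1 ≤ Q := by exact_mod_cast hr j
        linarith
      -- `Q x_j ≥ -N - r_j ≥ -N - Q + 1`, so `x_j ≥ -N/Q - 1 + 1/Q ≥ -2N`
      have h2 : (Q : ℝ) * x (Fin.castSucc j) ≥ -(N : ℝ) - Q + 1 := by linarith
      have h3 : (Q : ℝ) * (-(2 * (N : ℝ))) ≤ -(N : ℝ) - Q + 1 := by nlinarith
      nlinarith
  · refine Fin.lastCases ?_ (fun j => ?_) k
    · have := h.2 (Fin.last d)
      simp only [classRealMap, Fin.snoc_last] at this
      linarith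
    · have h1 := h.2 (Fin.castSucc j)
      simp only [classRealMap, Fin.snoc_castSucc] at h1
      have hrj : (0 : ℝ) ≤ r j := Nat.cast_nonneg _
      have h2 : (Q : ℝ) * x (Fin.castSucc j) ≤ N := by linarith
      have h3 : (N : ℝ) ≤ (Q : ℝ) * (2 * (N : ℝ)) := by nlinarith
      nlinarith

/-! ### The volume of a residue class body -/

/-- The diagonal entries `(Q, …, Q, 1)` of the linear part of `T_r`. [folklore] -/
def classDiag (d Q : ℕ) : Fin (d + 1) → ℝ :=
  Fin.snoc (fun _ : Fin d => (Q : ℝ)) 1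

/-- The translation vector `(r, 0)` of `T_r`. [folklore] -/
def classShift (r : Fin d → ℕ) : Fin (d + 1) → ℝ :=
  Fin.snoc (fun j => (r j : ℝ)) 0

/-- `T_r = (· + (r, 0)) ∘ diag(Q, …, Q, 1)`. [folklore] -/
theorem classRealMap_eq (Q : ℕ) (r : Fin d → ℕ) (x : Fin (d + 1) → ℝ) :
    classRealMap Q r x = Matrix.toLin' (Matrix.diagonal (classDiag d Q)) x + classShift r := by
  rw [Matrix.toLin'_apply]
  funext k
  rw [Pi.add_apply, Matrix.mulVec_diagonal]
  refine Fin.lastCases ?_ (fun j => ?_) k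
  · simp [classRealMap, classDiag, classShift]
  · simp [classRealMap, classDiag, classShift, add_comm]

/-- `det diag(Q, …, Q, 1) = Q^d`. [folklore] -/
theorem det_classDiag (d Q : ℕ) :
    LinearMap.det (Matrix.toLin' (Matrix.diagonal (classDiag d Q))) = (Q : ℝ) ^ d := by
  rw [LinearMap.det_toLin', Matrix.det_diagonal, Fin.prod_univ_castSucc]
  simp [classDiag]

/-- **`vol(K_r) = vol(K) / Q^d`** (`Q ≥ 1`). [folklore] -/
theorem volume_classBody (Q : ℕ) (hQ : 1 ≤ Q) (r : Fin d → ℕ) (K : Set (Fin (d + 1) → ℝ)) :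
    volume (classBody Q r K) = ENNReal.ofReal (((Q : ℝ) ^ d)⁻¹) * volume K := by
  have hQ0 : (0 : ℝ) < Q := by exact_mod_cast hQ
  set D := Matrix.toLin' (Matrix.diagonal (classDiag d Q)) with hD
  have hdet : LinearMap.det D = (Q : ℝ) ^ d := det_classDiag d Q
  have hdet0 : LinearMap.det D ≠ 0 := by rw [hdet]; positivity
  have hset : classBody Q r K = D ⁻¹' ((fun x => x + classShift r) ⁻¹' K) := by
    ext x
    simp only [classBody, Set.mem_preimage, classRealMap_eq, hD]
  rw [hset, MeasureTheory.Measure.addHaar_preimage_linearMap volume hdet0, measure_preimage_add_right,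
    hdet, abs_of_pos (by positivity)]

/-- The same in real numbers (for `K` of finite volume). [folklore] -/
theorem volume_classBody_toReal (Q : ℕ) (hQ : 1 ≤ Q) (r : Fin d → ℕ) (K : Set (Fin (d + 1) → ℝ)) :
    (volume (classBody Q r K)).toReal = ((Q : ℝ) ^ d)⁻¹ * (volume K).toReal := by
  rw [volume_classBody Q hQ r K, ENNReal.toReal_mul, ENNReal.toReal_ofReal (by positivity)]

/-! ### Counting a residue class through the rescaled body -/

open Classical in
/-- **The residue class of `r` in `K ∩ ℤ^{d+1}` is in bijection with `K_r ∩ ℤ^{d+1}`**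
(`n = (r + Q u', u_{d+1})`), for `K ⊆ [-N,N]^{d+1}`, `N ≥ 1`, `Q ≥ 1`, `r ∈ {0,…,Q-1}^d`. [folklore] -/
theorem card_residueClass_eq (Q : ℕ) (hQ : 1 ≤ Q) {r : Fin d → ℕ} (hr : ∀ j, r j < Q)
    {K : Set (Fin (d + 1) → ℝ)} {N : ℕ} (hN : 1 ≤ N) (hK : K ⊆ realBox (d + 1) N) :
    #{n ∈ latticeBox (d + 1) N | realPoint n ∈ K ∧ baseResidue Q n = r} =
      #{u ∈ latticeBox (d + 1) (2 * N) | realPoint u ∈ classBody Q r K} := by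
  have hQ0 : (0 : ℤ) < Q := by exact_mod_cast hQ
  -- membership in the lattice box from membership of the real point in the real box
  have box_of_real : ∀ (M : ℕ) (n : Fin (d + 1) → ℤ), realPoint n ∈ realBox (d + 1) M →
      n ∈ latticeBox (d + 1) M := by
    intro M n hn
    simp only [realBox, Set.mem_Icc, Pi.le_def, realPoint] at hn
    refine Fintype.mem_piFinset.mpr fun k => Finset.mem_Icc.mpr ⟨?_, ?_⟩
    · exact_mod_cast hn.1 k
    · exact_mod_cast hn.2 k
  symm
  refine Finset.card_nbij' (classLatticeMap Q r) (classLatticeInv Q) ?_ ?_ ?_ ?_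
  · -- `Λ_r` maps `K_r ∩ ℤ^{d+1}` into the class of `r`
    intro u hu
    obtain ⟨-, huK⟩ := Finset.mem_filter.mp (Finset.mem_coe.mp hu)
    simp only [classBody, Set.mem_preimage, ← realPoint_classLatticeMap] at huK
    refine Finset.mem_coe.mpr (Finset.mem_filter.mpr ⟨box_of_real N _ (hK huK), huK, funext fun j => ?_⟩)
    unfold baseResidue classLatticeMap
    simp only [Fin.snoc_castSucc]
    rw [Int.add_mul_emod_self_left, Int.emod_eq_of_lt (by positivity) (by exact_mod_cast hr j),
      Int.toNat_natCast]
  · -- the inverse maps the class into `K_r ∩ [-2N,2N]^{d+1}`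
    intro n hn
    obtain ⟨hbox, hnK, hres⟩ := Finset.mem_filter.mp (Finset.mem_coe.mp hn)
    have hnk : ∀ k, -(N : ℤ) ≤ n k ∧ n k ≤ N := fun k => Finset.mem_Icc.mp (Fintype.mem_piFinset.mp hbox k)
    -- `Λ_r (inv n) = n`
    have hinv : classLatticeMap Q r (classLatticeInv Q n) = n := by
      funext k
      refine Fin.lastCases ?_ (fun j => ?_) k
      · simp [classLatticeMap, classLatticeInv]
      · simp only [classLatticeMap, classLatticeInv, Fin.snoc_castSucc]
        have h1 : ((r j : ℕ) : ℤ) = n (Fin.castSucc j) % Q := by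
          rw [← hres]; exact natCast_baseResidue Q hQ n j
        rw [h1]
        exact Int.emod_add_mul_ediv _ _
    refine Finset.mem_coe.mpr (Finset.mem_filter.mpr ⟨?_, ?_⟩)
    · refine Fintype.mem_piFinset.mpr fun k => Finset.mem_Icc.mpr ?_
      refine Fin.lastCases ?_ (fun j => ?_) k
      · simp only [classLatticeInv, Fin.snoc_last]
        have := hnk (Fin.last d)
        push_cast
        constructor <;> linarith
      · simp only [classLatticeInv, Fin.snoc_castSucc]
        have h1 := hnk (Fin.castSucc j)
        have h2 : (n (Fin.castSucc j) / Q).natAbs ≤ (n (Fin.castSucc j)).natAbs := Int.natAbs_ediv_le_natAbs _ _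
        have h3 : (n (Fin.castSucc j)).natAbs ≤ N := by
          have := abs_le.mpr h1
          rw [Int.abs_eq_natAbs] at this
          exact_mod_cast this
        have h4 : |n (Fin.castSucc j) / Q| ≤ (2 * N : ℕ) := by
          rw [Int.abs_eq_natAbs]
          push_cast
          have : ((n (Fin.castSucc j) / Q).natAbs : ℤ) ≤ N := by exact_mod_cast h2.trans h3
          linarith
        push_cast at h4 ⊢
        exact abs_le.mp h4
    · show realPoint (classLatticeInv Q n) ∈ classBody Q r K
      rw [classBody, Set.mem_preimage, ← realPoint_classLatticeMap, hinv]
      exact hnK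
  · -- left inverse
    intro u _
    funext k
    refine Fin.lastCases ?_ (fun j => ?_) k
    · simp [classLatticeMap, classLatticeInv]
    · simp only [classLatticeMap, classLatticeInv, Fin.snoc_castSucc]
      rw [Int.add_mul_ediv_left _ _ hQ0.ne', Int.ediv_eq_zero_of_lt (by positivity) (by exact_mod_cast hr j),
        zero_add]
  · -- right inverse
    intro n hn
    obtain ⟨-, -, hres⟩ := Finset.mem_filter.mp (Finset.mem_coe.mp hn)
    funext k
    refine Fin.lastCases ?_ (fun j => ?_) k
    · simp [classLatticeMap, classLatticeInv]
    · simp only [classLatticeMap, classLatticeInv, Fin.snoc_castSucc]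
      have h1 : ((r j : ℕ) : ℤ) = n (Fin.castSucc j) % Q := by
        rw [← hres]; exact natCast_baseResidue Q hQ n j
      rw [h1]
      exact Int.emod_add_mul_ediv _ _

/-! ### Sums of periodic functions over `K ∩ ℤ^{d+1}` -/

open Classical in
/-- **Equidistribution of a periodic weight over a convex body**: for `K ⊆ [-N,N]^{d+1}` convex
(`N ≥ 1`), `Q ≥ 1`, and a `Q`-periodic `F : ℤ^d → ℝ` with `|F| ≤ F_max`,
`|∑_{n ∈ K ∩ ℤ^{d+1}} F(n₁,…,n_d) - vol(K) Q^{-d} ∑_{r ∈ (ℤ/Q)^d} F(r)| ≤ F_max Q^d (d+1) 4^d (2N)^d`.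
[cite: GreenTao2010, App. A (display after Cor. A.2)] -/
theorem abs_sum_periodic_sub_volume_mul_le (Q : ℕ) (hQ : 1 ≤ Q) {N : ℕ} (hN : 1 ≤ N)
    {K : Set (Fin (d + 1) → ℝ)} (hK : Convex ℝ K) (hKN : K ⊆ realBox (d + 1) N)
    (F : (Fin d → ℤ) → ℝ) (hper : ∀ w w' : Fin d → ℤ, (∀ j, ((w j : ℤ) : ZMod Q) = w' j) → F w = F w')
    {Fmax : ℝ} (hF : ∀ w, |F w| ≤ Fmax) :
    |∑ n ∈ (latticeBox (d + 1) N).filter (fun n => realPoint n ∈ K), F (Fin.init n) -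
        (volume K).toReal * (((Q : ℝ) ^ d)⁻¹ *
          ∑ r ∈ Fintype.piFinset (fun _ : Fin d => range Q), F (fun j => (r j : ℤ)))| ≤
      Fmax * (Q : ℝ) ^ d * (((d : ℝ) + 1) * 4 ^ d * ((2 * N : ℕ) : ℝ) ^ d) := by
  set S := (latticeBox (d + 1) N).filter (fun n => realPoint n ∈ K) with hS
  set R := Fintype.piFinset (fun _ : Fin d => range Q) with hR
  -- split the sum over residue classes of the base coordinates
  have hmaps : ∀ n ∈ S, baseResidue Q n ∈ R := fun n _ => baseResidue_mem Q hQ n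
  have hsplit : ∑ n ∈ S, F (Fin.init n) = ∑ r ∈ R, ∑ n ∈ S.filter (fun n => baseResidue Q n = r), F (Fin.init n) :=
    (Finset.sum_fiberwise_of_maps_to hmaps _).symm
  -- on the class of `r`, `F(init n) = F(r)`
  have hclass : ∀ r ∈ R, ∑ n ∈ S.filter (fun n => baseResidue Q n = r), F (Fin.init n) =
      #{u ∈ latticeBox (d + 1) (2 * N) | realPoint u ∈ classBody Q r K} * F (fun j => (r j : ℤ)) := by
    intro r hr
    have hrQ : ∀ j, r j < Q := fun j => Finset.mem_range.mp (Fintype.mem_piFinset.mp hr j)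
    rw [Finset.sum_congr rfl fun n hn => hper (Fin.init n) (fun j => (r j : ℤ)) fun j => by
      rw [← (Finset.mem_filter.mp hn).2]; exact init_cast_zmod_eq_baseResidue Q hQ n j,
      Finset.sum_const, nsmul_eq_mul]
    congr 2
    rw [← card_residueClass_eq Q hQ hrQ hN hKN, hS, Finset.filter_filter]
  rw [hsplit, Finset.sum_congr rfl hclass, Finset.mul_sum, Finset.mul_sum, ← Finset.sum_sub_distrib]
  -- each class: lattice points of `K_r` against `vol(K_r) = vol(K)/Q^d`
  have hterm : ∀ r ∈ R,
      |(#{u ∈ latticeBox (d + 1) (2 * N) | realPoint u ∈ classBody Q r K} : ℝ) * F (fun j => (r j : ℤ)) -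
          (volume K).toReal * (((Q : ℝ) ^ d)⁻¹ * F (fun j => (r j : ℤ)))| ≤
        Fmax * (((d : ℝ) + 1) * 4 ^ d * ((2 * N : ℕ) : ℝ) ^ d) := by
    intro r hr
    have hrQ : ∀ j, r j < Q := fun j => Finset.mem_range.mp (Fintype.mem_piFinset.mp hr j)
    have hcount := LatticePointsConvexBody.abs_card_sub_volume_le d (N := 2 * N) (by omega)
      (classBody Q r K) (convex_classBody Q r hK) (classBody_subset_realBox Q hQ hrQ hN hKN)
    rw [volume_classBody_toReal Q hQ] at hcount
    have heq : (#{u ∈ latticeBox (d + 1) (2 * N) | realPoint u ∈ classBody Q r K} : ℝ) * F (fun j => (r j : ℤ)) -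
        (volume K).toReal * (((Q : ℝ) ^ d)⁻¹ * F (fun j => (r j : ℤ))) =
        ((#{u ∈ latticeBox (d + 1) (2 * N) | realPoint u ∈ classBody Q r K} : ℝ) -
          ((Q : ℝ) ^ d)⁻¹ * (volume K).toReal) * F (fun j => (r j : ℤ)) := by ring
    rw [heq, abs_mul]
    have hF0 : 0 ≤ Fmax := (abs_nonneg _).trans (hF 0)
    calc _ ≤ (((d : ℝ) + 1) * 4 ^ d * ((2 * N : ℕ) : ℝ) ^ d) * Fmax :=
          mul_le_mul hcount (hF _) (abs_nonneg _) (by positivity)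
      _ = _ := by ring
  calc _ ≤ ∑ r ∈ R, |(#{u ∈ latticeBox (d + 1) (2 * N) | realPoint u ∈ classBody Q r K} : ℝ) *
        F (fun j => (r j : ℤ)) - (volume K).toReal * (((Q : ℝ) ^ d)⁻¹ * F (fun j => (r j : ℤ)))| :=
        Finset.abs_sum_le_sum_abs _ _
    _ ≤ ∑ _r ∈ R, Fmax * (((d : ℝ) + 1) * 4 ^ d * ((2 * N : ℕ) : ℝ) ^ d) := Finset.sum_le_sum hterm
    _ = _ := by
        rw [Finset.sum_const, nsmul_eq_mul, hR, Fintype.card_piFinset, Finset.prod_const, Finset.card_range,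
          Finset.card_univ, Fintype.card_fin]
        push_cast
        ring

end Summit.Parity.GeneralizedHardyLittlewood.Theorems
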